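import Literature.NumberTheory.Automorphic.GodementJacquetBoundaryValues

/-!
# The partial standard `L`-functions of cuspidal `GL_n`, `n ≥ 2`, are entire — from the
simultaneous spherical vector

Summit `Langlands`, sub-problem `Langlands`, helper file under `Theorems/` supporting the crux
`PairLBoundaryJS` (stmt-Langlands-13622, Arthur–Clozel (1989), Ch. 3, (2.2)), line `Sketch`, stub
`stub_standard_entire_of_ssv`.

`hasEntireContinuation_partialStandardL_of_ssv` (**main**): granted the *simultaneous spherical
vector* (a cuspidal `Π` on `GL_n(𝔸_K)` unramified at every finite place outside `S` has a non-zero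
vector fixed by a principal congruence subgroup `K(𝔫)`, `𝔫 ≠ 0`, all of whose primes lie in `S`),
for every cuspidal `Π` on `GL_n(𝔸_K)` with `n ≥ 2`, every finite `S` and every honest Satake family
`γ` of `Π` off `S`, the partial standard `L`-function `L^S(s, Π) = partialStandardL S γ` extends from
`Re s > 1` to an entire function (Godement–Jacquet, LNM 260 (1972), Thm. 13.8, in the tree's partial
rendering). Today the tree has this conclusion only from the unproved named fact `godementJacquet`
(`hasEntireContinuation_partialStandardL_of_godementJacquet`); here it is derived from theorems of the
tree and the one hypothesis.

Proof (the road of `exists_tendsto_partialStandardL_of_two_le` of `GodementJacquetBoundaryValues`,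
patched over the plane): `γ` witnesses that `Π` is unramified off `S`, so the hypothesis gives a level
`𝔫₀ ≠ 0` supported on `S` with `Π^{K(𝔫₀)} ≠ 0`; by Borel–Jacquet §4.6
(`exists_isKFiniteVector_of_mem_fixed`) there is a non-zero `K`-finite `K(𝔫₀)`-fixed `φ ∈ Π`, fixed
by `ι_v(GL_n(𝒪_v))` for every `v ∉ S` (`awayLevel_le_principalCongruenceLevel`). For each `s₀ ∈ ℂ`
the unfolding data adapted to `s₀ + (n-1)/2` with level of primes exactly `S`
(`exists_unfolding_data_at`) and the zeta quotient `Z = A · L^S` on a right half-plane, `Z`, `A`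
entire, `A(s₀) ≠ 0` (`exists_entire_eq_mul_partialStandardL_of_two_le`, i.e. Godement–Jacquet's
entire continuation of the global zeta integral for `n ≥ 2` and the `K^S`-spherical unfolding) give
`Z = A · L^S` on all of `Re s > 1` by the identity theorem (`L^S` is holomorphic there by
Jacquet–Shalika (5.3), `differentiableOn_partialStandardL_of_summable` with
`summable_normSq_trace_satakePow_holds`); the quotients `Z / A` patch to an entire function equal to
`L^S` on `Re s > 1` (`exists_differentiable_eqOn_of_entire_quotients`).

## References

* R. Godement, H. Jacquet, *Zeta functions of simple algebras*, LNM 260 (1972), §§12–13, Thm. 13.8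
  [GodementJacquet1972].
* H. Jacquet, J. A. Shalika, *On Euler products and the classification of automorphic
  representations I*, Amer. J. Math. 103 (1981), Thm. (5.3) [JacquetShalikaAJM1981].
* A. Borel, H. Jacquet, *Automorphic forms and automorphic representations*, Proc. Sympos. Pure
  Math. 33.1 (1979), §4.6 [BorelJacquet1979].
* J. W. Cogdell, *Analytic theory of `L`-functions for `GL_n`*, in *An Introduction to the Langlands
  Program* (2004), §4.2 [CogdellAnalyticTheory2004].
-/

noncomputable section

-- `Summit.Langlands.Langlands.…` (summit = sub-problem name, D-0017 layout) trips `dupNamespace`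
set_option linter.dupNamespace false

open scoped MatrixGroups Topology Pointwise ENNReal NNReal ComplexConjugate InnerProductSpace
open NumberField IsDedekindDomain MeasureTheory Measure Matrix Set Filter
open Literature.NumberTheory.Automorphic AdelicGroupData

namespace Summit.Langlands.Langlands.Theorems

/-- **The zeta quotient of `L^S(s, Π)` at a point, on all of `Re s > 1`** (rank `n ≥ 2`). For `Π`
cuspidal on `GL_n(𝔸_K)`, `S` finite, `γ` an honest Satake family of `Π` off `S`, and a non-zero
`K`-finite `φ ∈ Π` fixed by a principal congruence subgroup `K(𝔫₀)`, `𝔫₀ ≠ 0`, whose primes lie in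
`S`: for every `s₀ ∈ ℂ` there are ENTIRE `Z`, `A` with `A(s₀) ≠ 0` and `Z(s) = A(s) L^S(s, γ)` for
`Re s > 1` — the unfolding data adapted to `s₀ + (n-1)/2` with level of primes exactly `S`
(`exists_unfolding_data_at`; `φ` is fixed by `ι_v(GL_n(𝒪_v))`, `v ∉ S`, by
`awayLevel_le_principalCongruenceLevel`), the zeta quotient on a right half-plane
(`exists_entire_eq_mul_partialStandardL_of_two_le`: Godement–Jacquet's entire continuation of the
global zeta integral, `n ≥ 2`, and the `K^S`-spherical unfolding), continued down to `Re s > 1` by the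
identity theorem (`eqOn_halfPlane_of_eqOn_right`), `L^S` being holomorphic there (Jacquet–Shalika
(1981), Thm. (5.3): `differentiableOn_partialStandardL_of_summable` with
`summable_normSq_trace_satakePow_holds`). -/
theorem exists_entire_eq_mul_partialStandardL_halfPlane_of_fixed {n : ℕ} {K : Type} [Field K]
    [NumberField K] {μ : Measure (gl n K).automorphicQuotient} [(gl n K).IsAutomorphicMeasure μ]
    (hn : 2 ≤ n) (Q : CuspidalAutomorphicRepGL n K μ) (S : Finset (HeightOneSpectrum (𝓞 K)))
    {γ : SatakeFamily K} (hγ : IsSatakeFamilyOf Q (↑S : Set (HeightOneSpectrum (𝓞 K))) γ)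
    {𝔫₀ : Ideal (𝓞 K)} (h𝔫₀ : 𝔫₀ ≠ 0) (hT : ∀ w : HeightOneSpectrum (𝓞 K), w.asIdeal ∣ 𝔫₀ → w ∈ S)
    {φ : (gl n K).L2 μ} (hφP : φ ∈ Q.1) (hφ0 : φ ≠ 0) (hφK : IsKFiniteVector μ φ)
    (hφfix : ∀ u ∈ principalCongruenceLevel n K 𝔫₀, (gl n K).rightRegular μ u φ = φ) (s₀ : ℂ) :
    ∃ Z A : ℂ → ℂ, Differentiable ℂ Z ∧ Differentiable ℂ A ∧ A s₀ ≠ 0 ∧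
      ∀ s : ℂ, 1 < s.re → Z s = A s * partialStandardL (↑S : Set (HeightOneSpectrum (𝓞 K))) γ s := by
  -- `φ` is fixed by `ι_v(GL_n(𝒪_v))` for every `v ∉ S`
  have hfix : ∀ v ∉ S, ∀ x ∈ valuedCongruenceSubgroup (Fin n) (1 : WithZero (Multiplicative ℤ)),
      (gl n K).rightRegular μ (GLn.ofLocal n K v x) φ = φ := fun v hv x hx =>
    hφfix _ (awayLevel_le_principalCongruenceLevel h𝔫₀ hT (ofLocal_mem_awayLevel_of_mem hv hx))
  -- unfolding data adapted to the point, level of primes exactly `S`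
  obtain ⟨𝔫, h𝔫, Φinf, N, hTS, hΦ01, hΦ1, hN, hsupp⟩ :=
    exists_unfolding_data_at S hφ0 hfix (s₀ + ((n : ℂ) - 1) / 2)
  subst hTS
  have hφT : ∀ k ∈ awayLevel K n (primesOf h𝔫), (gl n K).rightRegular μ k φ = φ :=
    fun k hk => hφfix k (awayLevel_le_principalCongruenceLevel h𝔫₀ hT hk)
  -- the zeta quotient on a right half-plane
  obtain ⟨Z, A, x₀, hZ, hA, hA0, hZA⟩ := exists_entire_eq_mul_partialStandardL_of_two_le hn Q h𝔫 hγ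
    hφP hφ0 hφK hφT hΦ01 hΦ1 hN s₀ hsupp
  -- continued down to `Re s > 1` by the identity theorem
  refine ⟨Z, A, hZ, hA, hA0, ?_⟩
  have hL : DifferentiableOn ℂ
      (fun s => A s * partialStandardL (↑(primesOf h𝔫) : Set (HeightOneSpectrum (𝓞 K))) γ s)
      {s : ℂ | 1 < s.re} :=
    hA.differentiableOn.mul
      (differentiableOn_partialStandardL_of_summable summable_normSq_trace_satakePow_holds Q hγ)
  exact eqOn_halfPlane_of_eqOn_right (x₀ := max x₀ 1) hZ hL (le_max_right x₀ 1)
    fun s hs => hZA s (lt_of_le_of_lt (le_max_left _ _) hs)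

/-- **The partial standard `L`-functions of cuspidal `GL_n`, `n ≥ 2`, are entire, from the
simultaneous spherical vector** (Godement–Jacquet, LNM 260 (1972), Thm. 13.8, partial rendering).
Assume (ssv): every cuspidal `Π` on `GL_n(𝔸_K)` unramified at every finite place outside `S` has a
non-zero `K(𝔫)`-fixed vector for some `𝔫 ≠ 0` all of whose primes lie in `S`. Then for `n ≥ 2`,
every cuspidal `Π`, every finite `S` and every honest Satake family `γ` of `Π` off `S`,
`L^S(s, Π) = partialStandardL S γ` has an entire continuation: `γ` makes `Π` unramified off `S`
(`IsSatakeFamilyOf.isUnramifiedAt`), (ssv) gives the level `𝔫₀`, Borel–Jacquet §4.6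
(`exists_isKFiniteVector_of_mem_fixed`, `principalCongruenceLevel_mem_finiteLevelsGL_holds`) a non-zero
`K`-finite `K(𝔫₀)`-fixed `φ ∈ Π`; the per-point zeta quotients `Z = A · L^S` on `Re s > 1`,
`A(s₀) ≠ 0` (`exists_entire_eq_mul_partialStandardL_halfPlane_of_fixed`) patch to an entire function
equal to `L^S` on `Re s > 1` (`exists_differentiable_eqOn_of_entire_quotients`; Cogdell (2004), §4.2:
"division by these factors can introduce no extraneous poles"). This is the right-hand side of
`MoeglinWaldspurger1989_partialPairL_entire_of_rank_ne_gl_one_iff_standard`, hence the `(n,1)` and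
`(1,n)` slices of Mœglin–Waldspurger (i)(a), free of `godementJacquet`. -/
theorem hasEntireContinuation_partialStandardL_of_ssv
    (hssv : ∀ {n : ℕ} {K : Type} [Field K] [NumberField K]
      {μ : Measure (gl n K).automorphicQuotient} [(gl n K).IsAutomorphicMeasure μ]
      (Q : CuspidalAutomorphicRepGL n K μ) {S : Set (HeightOneSpectrum (𝓞 K))},
      (∀ v ∉ S, IsUnramifiedAt Q.1 v) →
      ∃ 𝔫 : Ideal (𝓞 K), 𝔫 ≠ 0 ∧ (∀ w : HeightOneSpectrum (𝓞 K), w.asIdeal ∣ 𝔫 → w ∈ S) ∧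
        Q.1.fixedVectors (principalCongruenceLevel n K 𝔫) ≠ ⊥)
    {n : ℕ} {K : Type} [Field K] [NumberField K]
    {μ : Measure (gl n K).automorphicQuotient} [(gl n K).IsAutomorphicMeasure μ]
    (hn : 2 ≤ n) (Q : CuspidalAutomorphicRepGL n K μ) {S : Set (HeightOneSpectrum (𝓞 K))}
    (hS : S.Finite) {γ : SatakeFamily K} (hγ : IsSatakeFamilyOf Q S γ) :
    Literature.NumberTheory.GaloisRepresentations.LFunction.HasEntireContinuation
      (partialStandardL S γ) := by
  -- a level supported on `S`
  obtain ⟨𝔫₀, h𝔫₀, hT, hbot⟩ := hssv Q (S := S) fun v hv => hγ.isUnramifiedAt hv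
  -- a non-zero `K`-finite `K(𝔫₀)`-fixed vector of `Π`
  obtain ⟨f, hf, hf0⟩ := (Submodule.ne_bot_iff _).1 hbot
  have hf0' : (f : (gl n K).L2 μ) ≠ 0 := fun h => hf0 (Subtype.ext h)
  have hfix : ∀ u ∈ principalCongruenceLevel n K 𝔫₀, (gl n K).rightRegular μ u f = f := fun u hu => by
    have := (ContRepresentation.ClosedSubrep.mem_fixedVectors _ _ _).1 hf u hu
    exact congrArg Subtype.val this
  obtain ⟨φ, hφP, hφ0, hφfix, hφK⟩ := exists_isKFiniteVector_of_mem_fixed Q.1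
    (principalCongruenceLevel_mem_finiteLevelsGL_holds n K h𝔫₀) f.2 hf0' hfix
  -- `S` as a `Finset`
  obtain ⟨T, rfl⟩ : ∃ T : Finset (HeightOneSpectrum (𝓞 K)), (↑T : Set (HeightOneSpectrum (𝓞 K))) = S :=
    ⟨hS.toFinset, hS.coe_toFinset⟩
  have hT' : ∀ w : HeightOneSpectrum (𝓞 K), w.asIdeal ∣ 𝔫₀ → w ∈ T := fun w hw =>
    Finset.mem_coe.1 (hT w hw)
  -- patch the per-point zeta quotients over the plane
  obtain ⟨F, hF, hFL⟩ := exists_differentiable_eqOn_of_entire_quotients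
    (L := partialStandardL (↑T : Set (HeightOneSpectrum (𝓞 K))) γ) (x₀ := 1) fun s₀ =>
      exists_entire_eq_mul_partialStandardL_halfPlane_of_fixed hn Q T hγ h𝔫₀ hT' hφP hφ0 hφK hφfix s₀
  exact ⟨F, hF, hFL⟩

end Summit.Langlands.Langlands.Theorems

namespace Summit.Langlands.Langlands.Theorems.StandardEntire

/-- **Registered stub `stub_standard_entire_of_ssv` of the crux skeleton `PairLBoundaryJS`
(stmt-Langlands-13622, line `Sketch`), verbatim signature**: (simultaneous spherical vector) ⟹ for
`n ≥ 2` every partial standard `L`-function `L^S(s, Π) = partialStandardL S γ` of a cuspidal `Π` on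
`GL_n(𝔸_K)` (`S` finite, `γ` an honest Satake family off `S`) extends to an entire function — an
alias of `Summit.Langlands.Langlands.Theorems.hasEntireContinuation_partialStandardL_of_ssv`, kept in
the sub-namespace `StandardEntire` so that it does not clash with the skeleton's own declaration.
(Godement–Jacquet, LNM 260 (1972), Thm. 13.8.) -/
theorem stub_standard_entire_of_ssv :
    (∀ {n : ℕ} {K : Type} [Field K] [NumberField K]
      {μ : Measure (gl n K).automorphicQuotient} [(gl n K).IsAutomorphicMeasure μ]
      (Q : CuspidalAutomorphicRepGL n K μ) {S : Set (HeightOneSpectrum (𝓞 K))},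
      (∀ v ∉ S, IsUnramifiedAt Q.1 v) →
      ∃ 𝔫 : Ideal (𝓞 K), 𝔫 ≠ 0 ∧ (∀ w : HeightOneSpectrum (𝓞 K), w.asIdeal ∣ 𝔫 → w ∈ S) ∧
        Q.1.fixedVectors (principalCongruenceLevel n K 𝔫) ≠ ⊥) →
    ∀ {n : ℕ} {K : Type} [Field K] [NumberField K]
      {μ : Measure (gl n K).automorphicQuotient} [(gl n K).IsAutomorphicMeasure μ],
      2 ≤ n → ∀ (Q : CuspidalAutomorphicRepGL n K μ) {S : Set (HeightOneSpectrum (𝓞 K))}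
      (_hS : S.Finite) {γ : SatakeFamily K} (_hγ : IsSatakeFamilyOf Q S γ),
      Literature.NumberTheory.GaloisRepresentations.LFunction.HasEntireContinuation
        (partialStandardL S γ) :=
  fun hssv _ _ _ _ _ _ hn Q _ hS _ hγ => hasEntireContinuation_partialStandardL_of_ssv hssv hn Q hS hγ

end Summit.Langlands.Langlands.Theorems.StandardEntire

end
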